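import Summits.NavierStokesRegularity.NavierStokesRegularity.Theorems.ExtremalBiaxialitySubcritical.Negative.KinematicDecoyField
import HarnessLib

/-!
# Crux `ExtremalBiaxialitySubcritical`, negative side: the kinematic decoy, III — scaled local energies

Route `SqueezeCycle`, crux
`Summit.NavierStokesRegularity.NavierStokesRegularity.Theses.SqueezeCycle.ExtremalBiaxialitySubcritical`
(stmt-NavierStokesRegularity-11609). Extracted from the crux work file
`Cruxes/ExtremalBiaxialitySubcritical/Disproof.lean` (cdisprove adversary, generation 4, D-0016).
Part III: the integrals behind clause (H5) of `𝒦_C` for the decoy `u = φ(t) a W(x/δ)`.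

* slices: `∫‖u(t)‖² = (φ(t)a)² δ³ E₀`, `∫‖∇u(t)‖² = (φ(t)aδ⁻¹)² δ³ E₁` (`E₀ = ∫‖W‖²`, `E₁ = ∫‖DW‖²`;
  Haar scaling `Measure.integral_comp_inv_smul_of_nonneg`; integrability from continuity and compact
  support);
* balls: `∫_{B_r(x₀)} ‖u(t)‖² ≤ min((aM₀)² r³v₁, a²δ³E₀)`, `∫_{B_r(x₀)} ‖∇u(t)‖² ≤ min((aδ⁻¹M₁)² r³v₁,
  φ(t)² a²δE₁)` (`v₁` = volume of the unit ball, `Measure.addHaar_ball_of_pos`; `M₀, M₁` = sup of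
  `‖W‖, ‖DW‖`);
* cylinders: `∫_{t₀−r²}^{t₀} ∫_{B_r} ‖∇u‖² ≤ min(r² · (aδ⁻¹M₁)² r³ v₁, a² δ E₁)` using `∫ φ² ≤ 1`
  (`φ² ≤ 𝟙_{[−3/2,−1/2]}`).

References: Koch–Nadirashvili–Seregin–Šverák, Acta Math. 203 (2009) §1 (scale-invariant energies).
-/

noncomputable section

open Set Function Filter MeasureTheory Metric
open scoped RealInnerProductSpace ContDiff Topology

namespace Summit.NavierStokesRegularity.NavierStokesRegularity.Theorems.ExtremalBiaxialitySubcritical.Negative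

open Literature.Analysis.FluidPDE
open Summit.NavierStokesRegularity.NavierStokesRegularity.Theses

/-! ### Scaled local energies (H5): integrability and scaling -/

/-- The slices of the decoy have compact support (`δ ≠ 0`). [folklore] -/
theorem hasCompactSupport_decoy_slice {δ : ℝ} (hδ : δ ≠ 0) (a t : ℝ) :
    HasCompactSupport (decoy a δ t) := by
  have h : HasCompactSupport (fun x : EuclideanSpace ℝ (Fin 3) => decoyProfile (δ⁻¹ • x)) :=
    hasCompactSupport_decoyProfile.comp_smul (inv_ne_zero hδ)
  exact h.smul_left (f := fun _ => decoyTime t * a)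

/-- `x ↦ ‖u(t,x)‖²` is integrable. [folklore] -/
theorem integrable_norm_sq_decoy {δ : ℝ} (hδ : δ ≠ 0) (a t : ℝ) :
    Integrable (fun x => ‖decoy a δ t x‖ ^ 2) := by
  have hc : Continuous (fun x => ‖decoy a δ t x‖ ^ 2) :=
    ((contDiff_decoy_slice a δ t).continuous.norm).pow 2
  have hs : HasCompactSupport (fun x => ‖decoy a δ t x‖ ^ 2) :=
    (hasCompactSupport_decoy_slice hδ a t).norm.comp_left (g := fun r : ℝ => r ^ 2) (by simp)
  exact hc.integrable_of_hasCompactSupport hs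

/-- `x ↦ ‖∇u(t,x)‖²` is integrable. [folklore] -/
theorem integrable_norm_sq_fderiv_decoy {δ : ℝ} (hδ : δ ≠ 0) (a t : ℝ) :
    Integrable (fun x => ‖fderiv ℝ (decoy a δ t) x‖ ^ 2) := by
  have e : (fun x => ‖fderiv ℝ (decoy a δ t) x‖ ^ 2) =
      fun x => ‖(decoyTime t * a * δ⁻¹) • fderiv ℝ decoyProfile (δ⁻¹ • x)‖ ^ 2 := by
    funext x; rw [fderiv_decoy]
  rw [e]
  have hc0 : Continuous fun x : EuclideanSpace ℝ (Fin 3) => fderiv ℝ decoyProfile (δ⁻¹ • x) :=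
    continuous_fderiv_decoyProfile.comp (continuous_const_smul δ⁻¹)
  have hc1 : Continuous fun x : EuclideanSpace ℝ (Fin 3) =>
      (decoyTime t * a * δ⁻¹) • fderiv ℝ decoyProfile (δ⁻¹ • x) :=
    hc0.const_smul (decoyTime t * a * δ⁻¹)
  have hc : Continuous fun x : EuclideanSpace ℝ (Fin 3) =>
      ‖(decoyTime t * a * δ⁻¹) • fderiv ℝ decoyProfile (δ⁻¹ • x)‖ ^ 2 :=
    hc1.norm.pow 2
  have hs0 : HasCompactSupport fun x : EuclideanSpace ℝ (Fin 3) => fderiv ℝ decoyProfile (δ⁻¹ • x) :=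
    (hasCompactSupport_decoyProfile.fderiv (𝕜 := ℝ)).comp_smul (inv_ne_zero hδ)
  have hs : HasCompactSupport fun x : EuclideanSpace ℝ (Fin 3) =>
      ‖(decoyTime t * a * δ⁻¹) • fderiv ℝ decoyProfile (δ⁻¹ • x)‖ ^ 2 :=
    (hs0.smul_left (f := fun _ => decoyTime t * a * δ⁻¹)).norm.comp_left (g := fun r : ℝ => r ^ 2) (by simp)
  exact hc.integrable_of_hasCompactSupport hs

/-- `E₀ = ∫ ‖W‖²`. [folklore] -/
def profileEnergy : ℝ := ∫ x, ‖decoyProfile x‖ ^ 2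

/-- `E₁ = ∫ ‖DW‖²`. [folklore] -/
def profileGradEnergy : ℝ := ∫ x, ‖fderiv ℝ decoyProfile x‖ ^ 2

/-- `E₀ ≥ 0`. [folklore] -/
theorem profileEnergy_nonneg : 0 ≤ profileEnergy := integral_nonneg fun _ => sq_nonneg _

/-- `E₁ ≥ 0`. [folklore] -/
theorem profileGradEnergy_nonneg : 0 ≤ profileGradEnergy := integral_nonneg fun _ => sq_nonneg _

/-- `finrank ℝ ℝ³ = 3`. [folklore] -/
theorem finrank_R3 : Module.finrank ℝ (EuclideanSpace ℝ (Fin 3)) = 3 := finrank_euclideanSpace_fin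

/-- **Energy of a slice**: `∫ ‖u(t)‖² = (φ(t) a)² δ³ E₀`. [folklore] -/
theorem integral_norm_sq_decoy {δ : ℝ} (hδ : 0 < δ) (a t : ℝ) :
    ∫ x, ‖decoy a δ t x‖ ^ 2 = (decoyTime t * a) ^ 2 * δ ^ 3 * profileEnergy := by
  have e : (fun x => ‖decoy a δ t x‖ ^ 2) =
      fun x => (decoyTime t * a) ^ 2 * ‖decoyProfile (δ⁻¹ • x)‖ ^ 2 := by
    funext x
    rw [decoy, norm_smul, mul_pow, Real.norm_eq_abs, sq_abs]
  rw [e, integral_const_mul,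
    Measure.integral_comp_inv_smul_of_nonneg volume (fun y => ‖decoyProfile y‖ ^ 2) hδ.le,
    finrank_R3, smul_eq_mul, profileEnergy]
  ring

/-- **Enstrophy of a slice**: `∫ ‖∇u(t)‖² = (φ(t) a δ⁻¹)² δ³ E₁`. [folklore] -/
theorem integral_norm_sq_fderiv_decoy {δ : ℝ} (hδ : 0 < δ) (a t : ℝ) :
    ∫ x, ‖fderiv ℝ (decoy a δ t) x‖ ^ 2 = (decoyTime t * a * δ⁻¹) ^ 2 * δ ^ 3 * profileGradEnergy := by
  have e : (fun x => ‖fderiv ℝ (decoy a δ t) x‖ ^ 2) =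
      fun x => (decoyTime t * a * δ⁻¹) ^ 2 * ‖fderiv ℝ decoyProfile (δ⁻¹ • x)‖ ^ 2 := by
    funext x
    rw [fderiv_decoy, norm_smul, mul_pow, Real.norm_eq_abs, sq_abs]
  rw [e, integral_const_mul,
    Measure.integral_comp_inv_smul_of_nonneg volume (fun y => ‖fderiv ℝ decoyProfile y‖ ^ 2) hδ.le,
    finrank_R3, smul_eq_mul, profileGradEnergy]
  ring

/-- The volume of the unit ball of `ℝ³` (a finite positive number whose value is not needed). [folklore] -/
def unitBallVol : ℝ := (volume (ball (0 : EuclideanSpace ℝ (Fin 3)) 1)).toReal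

/-- `v₁ ≥ 0`. [folklore] -/
theorem unitBallVol_nonneg : 0 ≤ unitBallVol := ENNReal.toReal_nonneg

/-- `vol(B_r(x)) = r³ v₁`. [folklore] -/
theorem volume_real_ball {r : ℝ} (hr : 0 < r) (x : EuclideanSpace ℝ (Fin 3)) :
    volume.real (ball x r) = r ^ 3 * unitBallVol := by
  rw [measureReal_def, Measure.addHaar_ball_of_pos volume x hr, finrank_R3, ENNReal.toReal_mul,
    ENNReal.toReal_ofReal (by positivity), unitBallVol]

/-- A nonnegative function bounded by `B` integrates to at most `B r³ v₁` over a ball. [folklore] -/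
theorem setIntegral_ball_le {g : EuclideanSpace ℝ (Fin 3) → ℝ} {B r : ℝ} (hr : 0 < r)
    (x₀ : EuclideanSpace ℝ (Fin 3)) (hg0 : ∀ x, 0 ≤ g x) (hgB : ∀ x, g x ≤ B) :
    ∫ x in ball x₀ r, g x ≤ B * (r ^ 3 * unitBallVol) := by
  have h := norm_setIntegral_le_of_norm_le_const (μ := volume) (s := ball x₀ r) (f := g) (C := B)
    measure_ball_lt_top (fun x _ => by rw [Real.norm_of_nonneg (hg0 x)]; exact hgB x)
  rw [volume_real_ball hr] at h
  exact (Real.le_norm_self _).trans h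

/-- **Small balls, velocity**: `∫_{B_r(x₀)} ‖u(t)‖² ≤ (a M₀)² r³ v₁`. [folklore] -/
theorem setIntegral_norm_sq_decoy_le_vol {a M₀ r : ℝ} (ha : 0 ≤ a) (hM₀ : ∀ y, ‖decoyProfile y‖ ≤ M₀)
    (hr : 0 < r) (δ t : ℝ) (x₀ : EuclideanSpace ℝ (Fin 3)) :
    ∫ x in ball x₀ r, ‖decoy a δ t x‖ ^ 2 ≤ (a * M₀) ^ 2 * (r ^ 3 * unitBallVol) := by
  refine setIntegral_ball_le hr x₀ (fun x => sq_nonneg _) fun x => ?_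
  have hM : 0 ≤ M₀ := (norm_nonneg _).trans (hM₀ 0)
  have h1 : ‖decoy a δ t x‖ ≤ a * M₀ :=
    calc ‖decoy a δ t x‖ ≤ decoyTime t * a * M₀ := norm_decoy_le ha hM₀ δ t x
      _ ≤ 1 * a * M₀ := mul_le_mul_of_nonneg_right (mul_le_mul_of_nonneg_right (decoyTime_le_one t) ha) hM
      _ = a * M₀ := by ring
  exact pow_le_pow_left₀ (norm_nonneg _) h1 2

/-- **Large balls, velocity**: `∫_{B_r(x₀)} ‖u(t)‖² ≤ a² δ³ E₀`. [folklore] -/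
theorem setIntegral_norm_sq_decoy_le_energy {δ : ℝ} (hδ : 0 < δ) (a t r : ℝ) (x₀ : EuclideanSpace ℝ (Fin 3)) :
    ∫ x in ball x₀ r, ‖decoy a δ t x‖ ^ 2 ≤ a ^ 2 * δ ^ 3 * profileEnergy := by
  have h1 : ∫ x in ball x₀ r, ‖decoy a δ t x‖ ^ 2 ≤ ∫ x, ‖decoy a δ t x‖ ^ 2 :=
    setIntegral_le_integral (integrable_norm_sq_decoy hδ.ne' a t) (Eventually.of_forall fun _ => sq_nonneg _)
  refine h1.trans ?_
  rw [integral_norm_sq_decoy hδ]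
  have hφ : (decoyTime t * a) ^ 2 ≤ a ^ 2 := by
    rw [mul_pow]
    have h0 := decoyTime_nonneg t
    have h1 := decoyTime_le_one t
    nlinarith [sq_nonneg a, mul_le_one₀ h1 h0 h1]
  have hrest : 0 ≤ δ ^ 3 * profileEnergy := mul_nonneg (by positivity) profileEnergy_nonneg
  nlinarith

/-- **Small balls, gradient**: `∫_{B_r(x₀)} ‖∇u(t)‖² ≤ (a δ⁻¹ M₁)² r³ v₁`. [folklore] -/
theorem setIntegral_norm_sq_fderiv_decoy_le_vol {a δ M₁ r : ℝ} (ha : 0 ≤ a) (hδ : 0 < δ)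
    (hM₁ : ∀ y, ‖fderiv ℝ decoyProfile y‖ ≤ M₁) (hr : 0 < r) (t : ℝ) (x₀ : EuclideanSpace ℝ (Fin 3)) :
    ∫ x in ball x₀ r, ‖fderiv ℝ (decoy a δ t) x‖ ^ 2 ≤ (a * δ⁻¹ * M₁) ^ 2 * (r ^ 3 * unitBallVol) := by
  refine setIntegral_ball_le hr x₀ (fun x => sq_nonneg _) fun x => ?_
  have hM : 0 ≤ M₁ := (norm_nonneg _).trans (hM₁ 0)
  have hc : 0 ≤ a * δ⁻¹ := mul_nonneg ha (inv_nonneg.2 hδ.le)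
  have h1 : ‖fderiv ℝ (decoy a δ t) x‖ ≤ a * δ⁻¹ * M₁ := by
    rw [fderiv_decoy, norm_smul, Real.norm_of_nonneg (mul_nonneg (mul_nonneg (decoyTime_nonneg t) ha)
      (inv_nonneg.2 hδ.le))]
    calc decoyTime t * a * δ⁻¹ * ‖fderiv ℝ decoyProfile (δ⁻¹ • x)‖
        ≤ 1 * a * δ⁻¹ * M₁ := by
          apply mul_le_mul _ (hM₁ _) (norm_nonneg _) (by positivity)
          exact mul_le_mul_of_nonneg_right (mul_le_mul_of_nonneg_right (decoyTime_le_one t) ha)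
            (inv_nonneg.2 hδ.le)
      _ = a * δ⁻¹ * M₁ := by ring
  exact pow_le_pow_left₀ (norm_nonneg _) h1 2

/-- **Large balls, gradient**: `∫_{B_r(x₀)} ‖∇u(t)‖² ≤ φ(t)² (a² δ E₁)`. [folklore] -/
theorem setIntegral_norm_sq_fderiv_decoy_le_energy {δ : ℝ} (hδ : 0 < δ) (a t r : ℝ)
    (x₀ : EuclideanSpace ℝ (Fin 3)) :
    ∫ x in ball x₀ r, ‖fderiv ℝ (decoy a δ t) x‖ ^ 2 ≤ decoyTime t ^ 2 * (a ^ 2 * δ * profileGradEnergy) := by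
  have h1 : ∫ x in ball x₀ r, ‖fderiv ℝ (decoy a δ t) x‖ ^ 2 ≤ ∫ x, ‖fderiv ℝ (decoy a δ t) x‖ ^ 2 :=
    setIntegral_le_integral (integrable_norm_sq_fderiv_decoy hδ.ne' a t)
      (Eventually.of_forall fun _ => sq_nonneg _)
  refine h1.trans (le_of_eq ?_)
  rw [integral_norm_sq_fderiv_decoy hδ,
    show (decoyTime t * a * δ⁻¹) ^ 2 * δ ^ 3 * profileGradEnergy =
      decoyTime t ^ 2 * (a ^ 2 * δ * profileGradEnergy) * (δ⁻¹ * δ) ^ 2 by ring,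
    inv_mul_cancel₀ hδ.ne', one_pow, mul_one]

/-! ### Scaled local energies (H5): the time integral -/

/-- `φ²` is integrable. [folklore] -/
theorem integrable_decoyTime_sq : Integrable (fun t : ℝ => decoyTime t ^ 2) := by
  have hc : Continuous (fun t : ℝ => decoyTime t ^ 2) := (decoyTime.continuous).pow 2
  have hs0 : HasCompactSupport (fun t : ℝ => decoyTime t) := decoyTime.hasCompactSupport
  have hs : HasCompactSupport (fun t : ℝ => decoyTime t ^ 2) :=
    hs0.comp_left (g := fun r : ℝ => r ^ 2) (zero_pow two_ne_zero)
  exact hc.integrable_of_hasCompactSupport hs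

/-- `∫ φ² ≤ 1` (`φ² ≤ 𝟙_{[−3/2,−1/2]}`). [folklore] -/
theorem integral_decoyTime_sq_le_one : ∫ t, decoyTime t ^ 2 ≤ 1 := by
  have hI : Integrable fun t : ℝ => (Icc (-(3 / 2) : ℝ) (-(1 / 2))).indicator (fun _ => (1 : ℝ)) t :=
    (integrableOn_const (s := Icc (-(3 / 2) : ℝ) (-(1 / 2))) (hs := measure_Icc_lt_top.ne)).integrable_indicator
      measurableSet_Icc
  have h := integral_mono integrable_decoyTime_sq hI decoyTime_sq_le_indicator
  refine h.trans (le_of_eq ?_)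
  rw [integral_indicator_const _ measurableSet_Icc, Real.volume_real_Icc_of_le (by norm_num), smul_eq_mul]
  norm_num

/-- **Time integral, small radius**: `∫_{t₀−r²}^{t₀} ∫_{B_r} ‖∇u‖² ≤ r² · (a δ⁻¹ M₁)² r³ v₁`. [folklore] -/
theorem timeIntegral_grad_le_vol {a δ M₁ r : ℝ} (ha : 0 ≤ a) (hδ : 0 < δ)
    (hM₁ : ∀ y, ‖fderiv ℝ decoyProfile y‖ ≤ M₁) (hr : 0 < r) (t₀ : ℝ) (x₀ : EuclideanSpace ℝ (Fin 3)) :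
    ∫ t in Ioo (t₀ - r ^ 2) t₀, ∫ x in ball x₀ r, ‖fderiv ℝ (decoy a δ t) x‖ ^ 2 ≤
      r ^ 2 * ((a * δ⁻¹ * M₁) ^ 2 * (r ^ 3 * unitBallVol)) := by
  set B : ℝ := (a * δ⁻¹ * M₁) ^ 2 * (r ^ 3 * unitBallVol) with hB
  have hmono : ∫ t in Ioo (t₀ - r ^ 2) t₀, ∫ x in ball x₀ r, ‖fderiv ℝ (decoy a δ t) x‖ ^ 2 ≤
      ∫ t in Ioo (t₀ - r ^ 2) t₀, B := by
    refine integral_mono_of_nonneg (Eventually.of_forall fun t => ?_)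
      (integrableOn_const (hs := measure_Ioo_lt_top.ne)) ?_
    · exact setIntegral_nonneg measurableSet_ball fun x _ => sq_nonneg _
    · exact Eventually.of_forall fun t => setIntegral_norm_sq_fderiv_decoy_le_vol ha hδ hM₁ hr t x₀
  refine hmono.trans (le_of_eq ?_)
  rw [setIntegral_const, Real.volume_real_Ioo_of_le (by nlinarith), smul_eq_mul]
  ring

/-- **Time integral, large radius**: `∫_{t₀−r²}^{t₀} ∫_{B_r} ‖∇u‖² ≤ a² δ E₁`. [folklore] -/
theorem timeIntegral_grad_le_energy {δ : ℝ} (hδ : 0 < δ) (a r t₀ : ℝ) (x₀ : EuclideanSpace ℝ (Fin 3)) :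
    ∫ t in Ioo (t₀ - r ^ 2) t₀, ∫ x in ball x₀ r, ‖fderiv ℝ (decoy a δ t) x‖ ^ 2 ≤
      a ^ 2 * δ * profileGradEnergy := by
  set K : ℝ := a ^ 2 * δ * profileGradEnergy with hK
  have hK0 : 0 ≤ K := mul_nonneg (mul_nonneg (sq_nonneg _) hδ.le) profileGradEnergy_nonneg
  have hint : Integrable fun t => decoyTime t ^ 2 * K := integrable_decoyTime_sq.mul_const K
  have h1 : ∫ t in Ioo (t₀ - r ^ 2) t₀, ∫ x in ball x₀ r, ‖fderiv ℝ (decoy a δ t) x‖ ^ 2 ≤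
      ∫ t in Ioo (t₀ - r ^ 2) t₀, decoyTime t ^ 2 * K := by
    refine integral_mono_of_nonneg (Eventually.of_forall fun t => ?_) hint.integrableOn ?_
    · exact setIntegral_nonneg measurableSet_ball fun x _ => sq_nonneg _
    · exact Eventually.of_forall fun t => setIntegral_norm_sq_fderiv_decoy_le_energy hδ a t r x₀
  have h2 : ∫ t in Ioo (t₀ - r ^ 2) t₀, decoyTime t ^ 2 * K ≤ ∫ t, decoyTime t ^ 2 * K :=
    setIntegral_le_integral hint (Eventually.of_forall fun t => mul_nonneg (sq_nonneg _) hK0)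
  have h3 : ∫ t, decoyTime t ^ 2 * K ≤ K := by
    rw [integral_mul_const]
    calc (∫ t, decoyTime t ^ 2) * K ≤ 1 * K := mul_le_mul_of_nonneg_right integral_decoyTime_sq_le_one hK0
      _ = K := one_mul K
  exact h1.trans (h2.trans h3)


end Summit.NavierStokesRegularity.NavierStokesRegularity.Theorems.ExtremalBiaxialitySubcritical.Negative

end
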